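import Summits.NavierStokesRegularity.NavierStokesRegularity.Theorems.ArgmaxNearDoorsCompositionsShrinking
import Summits.NavierStokesRegularity.NavierStokesRegularity.Theorems.ArgmaxNearDoorsEngine
import Summits.NavierStokesRegularity.NavierStokesRegularity.Theorems.ArgmaxNearDoorsPlates
import HarnessLib

/-!
# S36 §A «ArgmaxNearDoors» — doors C♭ and C♯ CLOSED BY NAME (door C𝔞 lands in `…ArgmaxNearDoorsAnnulus`)

Summits-side closers (theorems only) for door family S36 §A of the `NoTypeII` door programme (nsreg-p1 g30,
ROUND-34 08b22d05361083d7; texts of record `r34/Sketch36.lean` v2 f0fe6d26e287c4b8 = tree P0 `…ArgmaxNearDoorsDefs` /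
`…ArgmaxNearDoorsCompositions` / `…ArgmaxNearDoorsCompositionsShrinking`, LEAD ns-s30-p1 g3). Each door is the
kernel-checked composition of P0 applied to the landed plates:

* door C♭ `argmaxNearCoherenceDoor_holds : ArgmaxNearCoherenceDoor` := `argmaxNearCoherenceDoor_of_engine` E♭ N♭
  (E♭ `nearEngine_holds`, `…ArgmaxNearDoorsEngine`, LEAD; N♭ `slabDissipationBudget_holds`, `…ArgmaxNearDoorsPlates`,
  ns-sfl-p1 g5; D♭ `localDepletion_holds` inside the composition, F `typeISmallFloor_holds` in S35's P0);
* door C♯ `argmaxShrinkingCoherenceDoor_holds : ArgmaxShrinkingCoherenceDoor` := `argmaxShrinkingCoherenceDoor_of_engine`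
  E♭w N♭β (`nearEngineWeighted_holds`, `shrinkingDissipationBudget_holds`).

Appended-to by the C𝔞 / later closers (append protocol). Seat ns-s29-p2 g4 on the LEAD's key 2026-08-28T17:28:24Z (a).

HONEST FRAME: regularity CRITERIA read at ONE POINT PER TIME (Constantin–Fefferman coherence charged on a ball around
the vorticity argmax, fixed radius / shrinking radius `r₀(T−t)^β`, `β < 1/3`); UNCONDITIONAL (no named-fact hypothesis);
item 0056 `NoTypeII` and NS regularity are NOT proved by this; `--supports stmt-NavierStokesRegularity-0056 --as helper`.
-/

noncomputable section

set_option linter.dupNamespace false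

namespace Summit.NavierStokesRegularity.NavierStokesRegularity.Theorems.ArgmaxDoors

/-- **Door S36-C♭ «ArgmaxNearCoherenceDoor» CLOSED BY NAME** (fixed charged radius): P0's composition
`argmaxNearCoherenceDoor_of_engine` applied to E♭ `nearEngine_holds` and N♭ `slabDissipationBudget_holds`. [folklore] -/
theorem argmaxNearCoherenceDoor_holds : ArgmaxNearCoherenceDoor :=
  argmaxNearCoherenceDoor_of_engine nearEngine_holds slabDissipationBudget_holds

/-- **Door S36-C♯ «ArgmaxShrinkingCoherenceDoor» CLOSED BY NAME** (charged radius `r₀(T−t)^β`, `0 < β < 1/3`): P0's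
composition `argmaxShrinkingCoherenceDoor_of_engine` applied to E♭w `nearEngineWeighted_holds` and N♭β
`shrinkingDissipationBudget_holds`. [folklore] -/
theorem argmaxShrinkingCoherenceDoor_holds : ArgmaxShrinkingCoherenceDoor :=
  argmaxShrinkingCoherenceDoor_of_engine nearEngineWeighted_holds shrinkingDissipationBudget_holds

end Summit.NavierStokesRegularity.NavierStokesRegularity.Theorems.ArgmaxDoors

end
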